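import Literature.Analysis.FunctionSpaces.TorusSpaceTime
import Literature.Analysis.FunctionSpaces.TorusCalculusProofs
import Literature.Analysis.FunctionSpaces.FlatTorus
import HarnessLib

/-!
# FunctionalMining — differentiation under `∫_{T^d}` with a `C¹` outer function

Search for candidate a priori estimates; no regularity claim. Cell `pub-nsfunc`, prove seat
(gen 10). Calculus tool for the K0 rows with non-smooth power weights (`∫(|S|²)^{q/2}`,
`∫(|u|²)^{s/2}` at non-integer `q/2`, `s/2`; SIEVELD §3.3/§3.5): for `θ` jointly smooth on
`[a, b] × T^d` and `Φ` of class `C¹` on an open set containing the values of `θ`,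
`d/dt ∫ Φ(θ) = ∫ Φ'(θ) ∂ₜθ` (one-sided within `[a, b]`). The tree's
`Torus.IsSmoothSpaceTimeOn.hasDerivWithinAt_integral` needs `Φ ∘ θ` jointly smooth; here the
pointwise chain rule, the tube lemma (the values `θ(s, ·)` stay in a compact thickening of
`θ(t, T^d)` inside `U` for `s` near `t`, where `Φ'` is bounded) and dominated convergence
(`Torus.hasDerivWithinAt_integral_of_convex`) give the `C¹` statement — the same argument as the
tree's `TorusWeightedVorticityBalanceC1` (Gibbon 2010 App. A for `Z_q`, real `q`), made reusable.

## Main statement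

* `C1Weight.hasDerivWithinAt_integral_comp_of_contDiffOn_one`.
-/

noncomputable section

open MeasureTheory Set Filter Topology

namespace Summit.NavierStokesRegularity.FunctionalMining

open Literature.Analysis.FunctionSpaces

namespace C1Weight

variable {d : Type*} [Fintype d]

/-- **Differentiation under `∫_{T^d}` with a `C¹` outer function.** For `θ` jointly smooth on
`[a, b] × T^d` (`a < b`) and `Φ` of class `C¹` on an open `U ⊇ θ([a, b] × T^d)`,
`s ↦ ∫ Φ(θ(s, x)) dx` has the one-sided derivative `∫ Φ'(θ(t, x)) ∂ₜθ(t, x) dx` within `[a, b]`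
at every `t ∈ [a, b]` (pointwise chain rule; the derivatives `Φ'(θ)∂ₜθ` are uniformly bounded for
`s` near `t` by the tube lemma — the values `θ(s, ·)` stay in a compact thickening of `θ(t, T^d)`
inside `U` — and dominated convergence, tree `Torus.hasDerivWithinAt_integral_of_convex`).
[folklore] -/
theorem hasDerivWithinAt_integral_comp_of_contDiffOn_one {a b : ℝ} (hab : a < b)
    {θ : ℝ → UnitAddTorus d → ℝ} (hθ : Torus.IsSmoothSpaceTimeOn (Icc a b) θ)
    {Φ : ℝ → ℝ} {U : Set ℝ} (hUo : IsOpen U) (hΦ : ContDiffOn ℝ 1 Φ U)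
    (hmaps : ∀ s ∈ Icc a b, ∀ x, θ s x ∈ U) {t : ℝ} (ht : t ∈ Icc a b) :
    HasDerivWithinAt (fun s => ∫ x, Φ (θ s x))
      (∫ x, deriv Φ (θ t x) * Torus.timeDerivWithin (Icc a b) θ t x) (Icc a b) t := by
  set S : Set ℝ := Icc a b with hSdef
  have hU : UniqueDiffOn ℝ S := uniqueDiffOn_Icc hab
  have hθc : ∀ s ∈ S, Continuous (θ s) := fun s hs => (hθ.isSmooth_slice hs).continuous
  have hΦc : ContinuousOn Φ U := hΦ.continuousOn
  have hΦ'c : ContinuousOn (deriv Φ) U := hΦ.continuousOn_deriv_of_isOpen hUo le_rfl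
  have hΦd : ∀ y ∈ U, HasDerivAt Φ (deriv Φ y) y := fun y hy =>
    ((hΦ.differentiableOn (by simp)).differentiableAt (hUo.mem_nhds hy)).hasDerivAt
  -- a compact thickening of the values at time `t` inside `U`, and a bound for `Φ'` there
  set K : Set ℝ := range (θ t) with hKdef
  have hKc : IsCompact K := isCompact_range (hθc t ht)
  have hKU : K ⊆ U := by
    rintro _ ⟨x, rfl⟩
    exact hmaps t ht x
  obtain ⟨ρ, hρ, hρU⟩ := hKc.exists_cthickening_subset_open hUo hKU
  have hK₁c : IsCompact (Metric.cthickening ρ K) := hKc.cthickening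
  obtain ⟨B, hB⟩ : ∃ B : ℝ, ∀ y ∈ Metric.cthickening ρ K, ‖deriv Φ y‖ ≤ B :=
    hK₁c.exists_bound_of_continuousOn (hΦ'c.mono hρU)
  have hB0 : 0 ≤ B :=
    (norm_nonneg _).trans (hB (θ t 0) (Metric.self_subset_cthickening K ⟨0, rfl⟩))
  -- a bound for the time derivative at time `t`
  have hDc : Continuous (Torus.timeDerivWithin S θ t) :=
    (hθ.isSmooth_timeDerivWithin hU ht).continuous
  obtain ⟨M, hM⟩ : ∃ M : ℝ, ∀ x, ‖Torus.timeDerivWithin S θ t x‖ ≤ M := by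
    obtain ⟨M, hM⟩ := isCompact_univ.exists_bound_of_continuousOn hDc.continuousOn
    exact ⟨M, fun x => hM x (mem_univ x)⟩
  -- the uniform bound on `Φ'(θ(s, x)) ∂ₜθ(s, x)` for `s` near `t`
  have hbound : ∀ᶠ s in 𝓝[S] t, ∀ x,
      ‖deriv Φ (θ s x) * Torus.timeDerivWithin S θ s x‖ ≤ B * (M + 1) := by
    filter_upwards [hθ.eventually_norm_sub_lt ht hρ,
      hθ.eventually_norm_timeDerivWithin_sub_lt hU ht one_pos] with s hs1 hs2 x
    have hy : θ s x ∈ Metric.cthickening ρ K := by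
      refine Metric.mem_cthickening_of_dist_le (θ s x) (θ t x) ρ K ⟨x, rfl⟩ ?_
      rw [Real.dist_eq]
      have h := hs1 x
      rw [Real.norm_eq_abs] at h
      exact h.le
    rw [norm_mul]
    refine mul_le_mul (hB _ hy) ?_ (norm_nonneg _) hB0
    calc ‖Torus.timeDerivWithin S θ s x‖
        ≤ ‖Torus.timeDerivWithin S θ t x‖ +
            ‖Torus.timeDerivWithin S θ s x - Torus.timeDerivWithin S θ t x‖ :=
          norm_le_norm_add_norm_sub' _ _
      _ ≤ M + 1 := add_le_add (hM x) (hs2 x).le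
  refine Torus.hasDerivWithinAt_integral_of_convex (μ := volume) (convex_Icc a b) ht
    (F := fun s x => Φ (θ s x))
    (F' := fun s x => deriv Φ (θ s x) * Torus.timeDerivWithin S θ s x) ?_ ?_ hbound ?_
  · intro s hs
    exact (hΦc.comp_continuous (hθc s hs) (hmaps s hs)).integrable_unitAddTorus
  · intro s hs x
    exact (hΦd _ (hmaps s hs x)).comp_hasDerivWithinAt s (hθ.hasDerivWithinAt_slice hs x)
  · exact ((hΦ'c.comp_continuous (hθc t ht) (hmaps t ht)).mul hDc).aestronglyMeasurable

end C1Weight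

end Summit.NavierStokesRegularity.FunctionalMining
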